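import Mathlib
import HarnessLib
import Summits.HubbardSuperconductivity.HubbardSuperconductivity.Theorems.WeakCouplingBCSKlCertB1gDopingWindowD010D020

/-!
# Route `WeakCouplingBCS` — support item `WcbcsKohnLuttingerB1g` (stmt-HubbardSuperconductivity-0158):
# the R2d certificate half in FORM (A), in the consumer's currency — the DOPING window `δ ∈ [0.10, 0.20]`

The certificate half of LADDER rung R2d has the form of record **(A) = theorem modulo certified computation**
(director-hubbard 2026-08-26T12:47Z): its hypotheses are the named, referee-replayed enclosure statements
`klCertB1gWinA.EnclosuresB1g`, `klCertB1gWinB.EnclosuresB1g`, `klCertB1gWinC.EnclosuresB1g` of the three window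
records (44 contiguous boxes on `μ ∈ [-0.42749, -0.1775]`, cell gate-hubbard-kl, HOME/MU-WINDOW.md).  The μ-window
statement is `klb1g_window_d010_d020`; its reading on the DOPING window of record `δ ∈ [0.10, 0.20]` (the currency of
the item `WcbcsKohnLuttingerB1g`, of the theorem-half leaves `H1TwoPointLimitKLScaleD` / `H1TwoPointLimitKLOnsetD` and
of the risk register; `μ(δ) = chemicalPotentialOfDensity ε₀ (1 - δ)`) is `klb1g_doping_window_d010_d020` over the
unconditional `muOfDoping_mem_window_d010_d020` (margin-2 g7; the window-end fillings are certified TWICE in the tree,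
by kernel-checked polygon certificates `muWinD010_filling_ge` / `muWinD020_filling_lt` and, independently, by the
`norm_num`-evaluated Taylor polygons `klfillL010_filling_ge` / `klfillU020_filling_le` of this seat).  This file adds
what the CONSUMER of the certificate half needs beyond selection — the certified SIGN and SIZE of the selected
coupling — and packages the whole:

* `klb1gd_window_b1g_le` — for a record accepted by the multiplicity-aware checker, a kernel-decided bound
  `rhohi ≤ -a` on every box's `B1g` Ritz row gives `channelInf ε₀ μ 1 B1g ≤ -a` on the record's window
  (`klb1g_ritz_upper`); for the three window records `a = 1/8` (`decide +kernel`; the weakest box, at the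
  `δ = 0.20` end, has `rhohi ≈ -0.1266`), whence `klb1g_formA_b1g_le_window` on `μ ∈ [-0.42749, -0.1775]`;
* `klb1g_formA_r2d_certificate` — **the R2d certificate half, form (A), δ-form**: for every `δ ∈ [0.10, 0.20]`,
  (i) SELECTION: for every `0 < U < 1` and every `χ ≠ B1g`,
  `channelInf ε₀ μ(δ) U B1g + (437/16384) U² ≤ channelInf ε₀ μ(δ) U χ` (`437/16384 ≈ 0.0267` = the smallest of
  the three record margins, a kernel decision), and (ii) ATTRACTION with a certified coefficient: for every real `U`,
  `channelInf ε₀ μ(δ) U B1g ≤ -(1/8) U²` (`U²`-homogeneity of the mean-zero `B1g` channel, `klhs_channelInf_sq`);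
* `klb1g_formA_klCoefficient_ge` — hence `1/8 ≤ -channelInf ε₀ μ(δ) 1 B1g` on the window: the onset leaf's
  `klCoefficientB1g(μ_δ)` is certified positive (and ≥ 1/8), uniformly on the window of record.

The existential item itself, modulo the same hypotheses, is the tree's `wcbcsKohnLuttingerB1g_of_window_d010_d020`
(explicit witnesses `a = 0.10`, `b = 0.20`, `γ = 437/16384`, `U₁ = 1` = the matrix (i) above).

References: S. Raghu, S. A. Kivelson, D. J. Scalapino, Phys. Rev. B 81 (2010) 224505, §II (7), (13), §III Fig. 2;
M. Reed, B. Simon, *Methods of Modern Mathematical Physics IV*, §XIII.1 (Ritz).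
-/

noncomputable section

-- the tree's namespace `Summit.<Summit>.<Problem>.Theorems` repeats the summit name by design (D-0017)
set_option linter.dupNamespace false

namespace Summit.HubbardSuperconductivity.HubbardSuperconductivity.Theorems

open MeasureTheory Literature.MathematicalPhysics.QuantumLattice CwKLChiralWindow
open Summit.HubbardSuperconductivity.HubbardSuperconductivity.Theses.WeakCouplingBCS

/-! ### Certified attraction of the `B1g` channel on a window record -/

/-- **`B1g` Ritz upper bound, uniformly on a window record.** If the record is accepted by the multiplicity-aware
checker, its enclosures hold, and every box's `B1g` Ritz row has `rhohi ≤ -a` (a kernel decision), then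
`channelInf ε₀ μ 1 B1g ≤ -a` for every `μ ∈ [c.mub, c.mua]` (cover logic + `klb1g_ritz_upper`). [cite: ReedSimonIV1978, §XIII.1] -/
theorem klb1gd_window_b1g_le (c : KLCert) (hc : c.checkB1gD = true) (hE : c.EnclosuresB1g) (a : ℚ)
    (ha : (c.boxes.all fun bx => decide (bx.bB1g.rhohi ≤ -a)) = true) :
    ∀ μ ∈ Set.Icc ((c.mub : ℚ) : ℝ) ((c.mua : ℚ) : ℝ),
      channelInf (squareDispersion 1 0) μ 1 D4Irrep.B1g ≤ -((a : ℚ) : ℝ) := by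
  obtain ⟨-, hboxes, hcover⟩ := klb1gd_coverLogic c hc
  intro μ hμ
  obtain ⟨bx, hbx, hlo, hhi⟩ := hcover μ hμ.1 hμ.2
  obtain ⟨hB, -⟩ := hboxes bx hbx
  obtain ⟨hER, -⟩ := hE bx hbx μ ⟨hlo, hhi⟩
  have hB' := hB
  simp only [KLBox.basicOKB1gD, Bool.and_eq_true, decide_eq_true_eq] at hB'
  obtain ⟨⟨⟨⟨⟨⟨⟨hb4, -⟩, hb0⟩, hritz⟩, -⟩, -⟩, -⟩, -⟩ := hB'
  have hμ' : μ ∈ Set.Ioo (-4 : ℝ) 0 :=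
    ⟨lt_of_lt_of_le (by exact_mod_cast hb4) hlo, lt_of_le_of_lt hhi (by exact_mod_cast hb0)⟩
  have hup := klb1g_ritz_upper hμ' bx.bB1g c.trials D4Irrep.B1g hritz (Or.inr (by decide)) hER
  have hrho : bx.bB1g.rhohi ≤ -a := by
    have h := List.all_eq_true.1 ha bx hbx
    simpa using h
  exact hup.trans (by exact_mod_cast hrho)

/-- Every box of `klCertB1gWinA` has `B1g` Ritz upper bound `rhohi ≤ -1/8` (kernel decision). [folklore] -/
theorem klCertB1gWinA_b1g_le : (klCertB1gWinA.boxes.all fun bx => decide (bx.bB1g.rhohi ≤ -(1 / 8))) = true := by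
  decide +kernel

/-- Every box of `klCertB1gWinB` has `B1g` Ritz upper bound `rhohi ≤ -1/8` (kernel decision). [folklore] -/
theorem klCertB1gWinB_b1g_le : (klCertB1gWinB.boxes.all fun bx => decide (bx.bB1g.rhohi ≤ -(1 / 8))) = true := by
  decide +kernel

/-- Every box of `klCertB1gWinC` has `B1g` Ritz upper bound `rhohi ≤ -1/8` (kernel decision). [folklore] -/
theorem klCertB1gWinC_b1g_le : (klCertB1gWinC.boxes.all fun bx => decide (bx.bB1g.rhohi ≤ -(1 / 8))) = true := by
  decide +kernel

/-- **Certified attraction on the whole window**, modulo the enclosures: for every `μ ∈ [-0.42749, -0.1775]`,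
`channelInf ε₀ μ 1 B1g ≤ -1/8` (the weakest box is at the `δ = 0.20` end, `rhohi ≈ -0.1266`). [cite: RaghuKivelsonScalapino2010, §III Fig. 2] -/
theorem klb1g_formA_b1g_le_window (hA : klCertB1gWinA.EnclosuresB1g) (hB : klCertB1gWinB.EnclosuresB1g)
    (hC : klCertB1gWinC.EnclosuresB1g) :
    ∀ μ ∈ Set.Icc (-0.42749 : ℝ) (-0.1775), channelInf (squareDispersion 1 0) μ 1 D4Irrep.B1g ≤ -(1 / 8 : ℝ) := by
  have wA := klb1gd_window_b1g_le klCertB1gWinA klCertB1gWinA_check hA (1 / 8) klCertB1gWinA_b1g_le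
  have wB := klb1gd_window_b1g_le klCertB1gWinB klCertB1gWinB_check hB (1 / 8) klCertB1gWinB_b1g_le
  have wC := klb1gd_window_b1g_le klCertB1gWinC klCertB1gWinC_check hC (1 / 8) klCertB1gWinC_b1g_le
  have eA1 : (((klCertB1gWinA).mub : ℚ) : ℝ) = -0.42749 := by
    show (((-42749 : ℚ) / 100000 : ℚ) : ℝ) = -0.42749
    push_cast; norm_num
  have eA2 : (((klCertB1gWinA).mua : ℚ) : ℝ) = -0.3775 := by
    show (((-151 : ℚ) / 400 : ℚ) : ℝ) = -0.3775
    push_cast; norm_num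
  have eB1 : (((klCertB1gWinB).mub : ℚ) : ℝ) = -0.3775 := by
    show (((-151 : ℚ) / 400 : ℚ) : ℝ) = -0.3775
    push_cast; norm_num
  have eB2 : (((klCertB1gWinB).mua : ℚ) : ℝ) = -0.2275 := by
    show (((-91 : ℚ) / 400 : ℚ) : ℝ) = -0.2275
    push_cast; norm_num
  have eC1 : (((klCertB1gWinC).mub : ℚ) : ℝ) = -0.2275 := by
    show (((-91 : ℚ) / 400 : ℚ) : ℝ) = -0.2275
    push_cast; norm_num
  have eC2 : (((klCertB1gWinC).mua : ℚ) : ℝ) = -0.1775 := by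
    show (((-71 : ℚ) / 400 : ℚ) : ℝ) = -0.1775
    push_cast; norm_num
  have ea : (((1 / 8 : ℚ) : ℚ) : ℝ) = (1 / 8 : ℝ) := by push_cast; norm_num
  rw [eA1, eA2, ea] at wA
  rw [eB1, eB2, ea] at wB
  rw [eC1, eC2, ea] at wC
  intro μ hμ
  by_cases h1 : μ ≤ -0.3775
  · exact wA μ ⟨hμ.1, h1⟩
  · by_cases h2 : μ ≤ -0.2275
    · exact wB μ ⟨by linarith, h2⟩
    · exact wC μ ⟨by linarith, hμ.2⟩

/-! ### The R2d certificate half, form (A), on the doping window -/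

/-- **R2d certificate half — form (A), δ-form.** Modulo the certified enclosures of the three window records: for every
hole doping `δ ∈ [0.10, 0.20]`, with `μ(δ) = chemicalPotentialOfDensity ε₀ (1 - δ)`:
(i) SELECTION — for every `0 < U < 1` and every `χ ≠ B1g`,
`channelInf ε₀ μ(δ) U B1g + (437/16384) U² ≤ channelInf ε₀ μ(δ) U χ`;
(ii) ATTRACTION — for every real `U`, `channelInf ε₀ μ(δ) U B1g ≤ -(1/8) U²`.
[cite: RaghuKivelsonScalapino2010, §III Fig. 2] -/
theorem klb1g_formA_r2d_certificate (hA : klCertB1gWinA.EnclosuresB1g) (hB : klCertB1gWinB.EnclosuresB1g)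
    (hC : klCertB1gWinC.EnclosuresB1g) :
    ∀ δ ∈ Set.Icc (0.10 : ℝ) 0.20,
      (∀ U ∈ Set.Ioo (0 : ℝ) 1, ∀ χ : D4Irrep, χ ≠ D4Irrep.B1g →
        channelInf (squareDispersion 1 0) (chemicalPotentialOfDensity (squareDispersion 1 0) (1 - δ)) U D4Irrep.B1g +
            (437 / 16384 : ℝ) * U ^ 2 ≤
          channelInf (squareDispersion 1 0) (chemicalPotentialOfDensity (squareDispersion 1 0) (1 - δ)) U χ) ∧
      (∀ U : ℝ, channelInf (squareDispersion 1 0) (chemicalPotentialOfDensity (squareDispersion 1 0) (1 - δ)) U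
          D4Irrep.B1g ≤ -(1 / 8 : ℝ) * U ^ 2) := by
  intro δ hδ
  have hμ := muOfDoping_mem_window_d010_d020 δ hδ
  set μ := chemicalPotentialOfDensity (squareDispersion 1 0) (1 - δ) with hμdef
  have hmo : μ ∈ Set.Ioo (-4 : ℝ) 0 := ⟨by linarith [hμ.1], by linarith [hμ.2]⟩
  have hγ : (437 / 16384 : ℝ) ≤ min (min ((klCertB1gWinA.gamma : ℚ) : ℝ) ((klCertB1gWinB.gamma : ℚ) : ℝ))
      ((klCertB1gWinC.gamma : ℚ) : ℝ) := by
    have hq : (437 / 16384 : ℚ) ≤ klCertB1gWinA.gamma ∧ (437 / 16384 : ℚ) ≤ klCertB1gWinB.gamma ∧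
        (437 / 16384 : ℚ) ≤ klCertB1gWinC.gamma := by
      refine ⟨?_, ?_, ?_⟩ <;> decide +kernel
    obtain ⟨h1, h2, h3⟩ := hq
    have h1' : ((437 / 16384 : ℚ) : ℝ) ≤ ((klCertB1gWinA.gamma : ℚ) : ℝ) := by exact_mod_cast h1
    have h2' : ((437 / 16384 : ℚ) : ℝ) ≤ ((klCertB1gWinB.gamma : ℚ) : ℝ) := by exact_mod_cast h2
    have h3' : ((437 / 16384 : ℚ) : ℝ) ≤ ((klCertB1gWinC.gamma : ℚ) : ℝ) := by exact_mod_cast h3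
    push_cast at h1' h2' h3'
    exact le_min (le_min h1' h2') h3'
  refine ⟨fun U hU χ hχ => ?_, fun U => ?_⟩
  · have h := klb1g_window_d010_d020 hA hB hC μ hμ U hU χ hχ
    nlinarith [sq_nonneg U]
  · have hfin : IsFiniteMeasure (fermiCurveMeasure (squareDispersion 1 0) μ) :=
      stub_klFiniteMeasure stub_klGradient stub_klHausdorffFinite μ hmo
    have hinv := stub_klD4Invariant stub_klGradient μ hmo
    have hhom : channelInf (squareDispersion 1 0) μ U D4Irrep.B1g =
        U ^ 2 * channelInf (squareDispersion 1 0) μ 1 D4Irrep.B1g :=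
      klhs_channelInf_sq stub_klKernelHS hmo U D4Irrep.B1g
        (fun ψ hψ => (stub_klMeanZero _ _ hfin hinv D4Irrep.B1g ψ (by decide) hψ).2)
    have h1 := klb1g_formA_b1g_le_window hA hB hC μ hμ
    rw [hhom]
    nlinarith [sq_nonneg U]


/-- **Positivity of the Kohn–Luttinger coefficient on the window, form (A)**: for every `δ ∈ [0.10, 0.20]`,
`1/8 ≤ -channelInf ε₀ μ(δ) 1 B1g` — the denominator of the onset scale in the leaf `H1TwoPointLimitKLOnsetD`
(`klCoefficientB1g(μ_δ) = -channelInf ε₀ μ_δ 1 B1g`) is certified positive, uniformly on the window of record.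
[cite: RaghuKivelsonScalapino2010, §III Fig. 2] -/
theorem klb1g_formA_klCoefficient_ge (hA : klCertB1gWinA.EnclosuresB1g) (hB : klCertB1gWinB.EnclosuresB1g)
    (hC : klCertB1gWinC.EnclosuresB1g) :
    ∀ δ ∈ Set.Icc (0.10 : ℝ) 0.20,
      (1 / 8 : ℝ) ≤ -channelInf (squareDispersion 1 0) (chemicalPotentialOfDensity (squareDispersion 1 0) (1 - δ)) 1
        D4Irrep.B1g := by
  intro δ hδ
  have h := (klb1g_formA_r2d_certificate hA hB hC δ hδ).2 1
  norm_num at h ⊢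
  linarith

end Summit.HubbardSuperconductivity.HubbardSuperconductivity.Theorems

end
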